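import Summits.BirchSwinnertonDyer.Rank1Residual.ManinAdditive.UDCKummerWitnessLineB
import Summits.BirchSwinnertonDyer.BirchSwinnertonDyer.Theorems.ManinLocalTwoThreeQExpansionExtension
import HarnessLib

/-!
# The UDC witness line: (QXP) HOLDS, and the edges (WL♭) ⟹ (WL), (WL♭) ⟹ (AN♮) unconditionally (cell bsd-f2-manin, typer g20, T-an-44; B-line APPEND T-an-45)

Companion of `UDCKummerWitnessLine.lean` (an g38, T-an-44, p729921).  Of the seven typed pieces of the C3 witness law, the generic
`q`-EXPANSION EXTENSION PRINCIPLE (QXP) `UDCKummerWitnessLine.QExpansionExtensionPrinciple` («a holomorphic `f : ℍ → ℂ` given by a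
`q`-series `Σ bₙ e^{2πiτn}` for `Im τ > B` is given by it on all of `ℍ`») is a THEOREM of the tree: it is, up to the order of binders,
the C3 LEAD's `Summit.BirchSwinnertonDyer.BirchSwinnertonDyer.Theorems.ManinLocalTwoThree.QExpansionExtension.hasSum_exp_of_hasSum_of_lt_im`
(p729478, `Theorems/ManinLocalTwoThreeQExpansionExtension.lean`: `1`-periodicity by the identity theorem, boundedness at `i∞`,
Mathlib's `UpperHalfPlane.hasSum_qExpansion`, uniqueness of the cusp-function power series).  Hence:

* `qExpansionExtensionPrinciple_holds : QExpansionExtensionPrinciple`;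
* `kummerCubeRootModularFormWitness_of_nearCusp'` — (WL♭) ⟹ (WL) with (QXP) discharged;
* `kummerCubeRootModularFormWitness_of_pieces'` — (INT) → (ALG) → (DICT) → (EXT) → (QEXN) → (INV) → (WL), six pieces instead of seven;
* `kummerCubeRootCongruenceOfBoundedOfUDC_of_nearCusp` — (WL♭) ⟹ (AN♮) `UDCKummerLine.KummerCubeRootCongruenceOfBoundedOfUDC`, which is
  the LEAD's landed glue `UDCGlue.kummerCubeRootCongruenceOfBoundedOfUDC_of_modularFormWitness_of_lt_im` (p729478) read on the named node
  (its hypothesis type IS (WL♭), verbatim);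
* `kummerCubeRootCongruenceOfBoundedOfUDC_of_pieces` — the six open/closed-by-name pieces ⟹ (AN♮).
* APPEND (T-an-45, B-LINE `UDCKummerWitnessLineB.lean`, p730675): `kummerCubeRootModularFormWitness_of_piecesB'` — (INT) → (DICT) → (RATB) →
  (HOLB) → (QEXNB) → (INVB) → (WL) with (QXP) discharged, and `kummerCubeRootCongruenceOfBoundedOfUDC_of_piecesB` — the same six ⟹ (AN♮)
  (an's glue check ByName82d-g38.lean ef86ff2eec39a57c, now in the tree).

The other closed-by-name piece, (INT) `MinimalKummerCubeRootIntegral` (= the first clauses of p3's `MinimalCubeRoot.exists_int_minimalCubeRoot`,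
p728452), is NOT discharged here: its module `Theorems.ManinLocalTwoThreeMinimalCubeRootIntegral` imports the route thesis (Theses cone), which a
`ManinAdditive` statement-layer file may not import — that discharge belongs in the C3 LEAD's skeleton / a `Theorems/` file (p-seats).
Imports: the landed `UDCKummerWitnessLineB` (p730675; it imports `UDCKummerWitnessLine` p729921) and the LEAD's
`Theorems.ManinLocalTwoThreeQExpansionExtension` (p729478; Theses-free cone).
Theorem-only file; no new `def`, no `sorry`, standard axioms.  CONDITIONAL reductions: (WL), (WL♭), (AN♮) and C3 `ManinPrimeToThreeAtNine`
(stmt-BirchSwinnertonDyer-22968) stay OPEN; BSD is not proved by this.  PARTITION 3. [folklore]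
-/

set_option autoImplicit false

noncomputable section

open Summit.BirchSwinnertonDyer.Rank1Residual.ManinAdditive.UDCKummerLine
open Summit.BirchSwinnertonDyer.BirchSwinnertonDyer.Theorems.ManinLocalTwoThree

namespace Summit.BirchSwinnertonDyer.Rank1Residual.ManinAdditive.UDCKummerWitnessLine

/-- **(QXP) holds**: the `q`-expansion extension principle is the C3 LEAD's theorem
`QExpansionExtension.hasSum_exp_of_hasSum_of_lt_im` (p729478). [folklore] -/
theorem qExpansionExtensionPrinciple_holds : QExpansionExtensionPrinciple :=
  fun _f hf _b _B hs τ ↦ QExpansionExtension.hasSum_exp_of_hasSum_of_lt_im hf hs τ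

/-- **(WL♭) ⟹ (WL)** unconditionally: the integer `q`-series of the relaxed witness extends from `Im τ > B` to all of `ℍ`. [folklore] -/
theorem kummerCubeRootModularFormWitness_of_nearCusp' (hNear : KummerCubeRootModularFormWitnessNearCusp) :
    KummerCubeRootModularFormWitness :=
  kummerCubeRootModularFormWitness_of_nearCusp hNear qExpansionExtensionPrinciple_holds

/-- **(INT) → (ALG) → (DICT) → (EXT) → (QEXN) → (INV) → (WL)** — an's composition with the seventh piece (QXP) discharged.
CONDITIONAL reduction; (WL) and C3 OPEN. [folklore] -/
theorem kummerCubeRootModularFormWitness_of_pieces'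
    (hINT : MinimalKummerCubeRootIntegral) (hALG : KummerPoleValuesAlgebraic) (hDICT : KummerMinimalDictionary)
    (hEXT : KummerMinimalWitnessExtension) (hQEXN : IntegralQSeriesNearCusp) (hINV : KummerMinimalWitnessInvariance) :
    KummerCubeRootModularFormWitness :=
  kummerCubeRootModularFormWitness_of_pieces hINT hALG hDICT hEXT hQEXN hINV qExpansionExtensionPrinciple_holds

/-- **(WL♭) ⟹ (AN♮)** `KummerCubeRootCongruenceOfBoundedOfUDC`: the C3 LEAD's landed glue
`UDCGlue.kummerCubeRootCongruenceOfBoundedOfUDC_of_modularFormWitness_of_lt_im` (p729478), whose hypothesis type is (WL♭) verbatim,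
read on the named node.  CONDITIONAL reduction; (AN♮) and C3 OPEN. [folklore] -/
theorem kummerCubeRootCongruenceOfBoundedOfUDC_of_nearCusp (hNear : KummerCubeRootModularFormWitnessNearCusp) :
    KummerCubeRootCongruenceOfBoundedOfUDC :=
  UDCGlue.kummerCubeRootCongruenceOfBoundedOfUDC_of_modularFormWitness_of_lt_im hNear

/-- **(INT) → (ALG) → (DICT) → (EXT) → (QEXN) → (INV) → (AN♮)**: the UDC line's analytic node from an's six pieces
((INT) closed by name Theorems-side, p728452; (QXP) discharged above).  CONDITIONAL reduction; (AN♮) and C3 OPEN;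
BSD is not proved by this. [folklore] -/
theorem kummerCubeRootCongruenceOfBoundedOfUDC_of_pieces
    (hINT : MinimalKummerCubeRootIntegral) (hALG : KummerPoleValuesAlgebraic) (hDICT : KummerMinimalDictionary)
    (hEXT : KummerMinimalWitnessExtension) (hQEXN : IntegralQSeriesNearCusp) (hINV : KummerMinimalWitnessInvariance) :
    KummerCubeRootCongruenceOfBoundedOfUDC :=
  kummerCubeRootCongruenceOfBoundedOfUDC_of_nearCusp
    (kummerCubeRootModularFormWitnessNearCusp_of_pieces hINT hALG hDICT hEXT hQEXN hINV)

/-! ## APPEND (T-an-45): the B-LINE compositions with (QXP) discharged -/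

/-- **(INT) → (DICT) → (RATB) → (HOLB) → (QEXNB) → (INVB) → (WL)** — an's B-line composition (`UDCKummerWitnessLineB.lean`, p730675) with the
seventh piece (QXP) discharged.  CONDITIONAL reduction; (WL) and C3 OPEN. [folklore] -/
theorem kummerCubeRootModularFormWitness_of_piecesB'
    (hINT : MinimalKummerCubeRootIntegral) (hDICT : KummerMinimalDictionary) (hRATB : KummerMinimalParamPresentation)
    (hHOLB : KummerMinimalWitnessExtensionB) (hQEXNB : IntegralQSeriesNearCuspB) (hINVB : KummerMinimalWitnessInvarianceB) :
    KummerCubeRootModularFormWitness :=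
  kummerCubeRootModularFormWitness_of_piecesB hINT hDICT hRATB hHOLB hQEXNB hINVB qExpansionExtensionPrinciple_holds

/-- **(INT) → (DICT) → (RATB) → (HOLB) → (QEXNB) → (INVB) → (AN♮)**: the UDC line's analytic node from an's six B-LINE pieces
((INT) closed by name Theorems-side, p728452).  CONDITIONAL reduction; (AN♮) and C3 OPEN; BSD is not proved by this. [folklore] -/
theorem kummerCubeRootCongruenceOfBoundedOfUDC_of_piecesB
    (hINT : MinimalKummerCubeRootIntegral) (hDICT : KummerMinimalDictionary) (hRATB : KummerMinimalParamPresentation)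
    (hHOLB : KummerMinimalWitnessExtensionB) (hQEXNB : IntegralQSeriesNearCuspB) (hINVB : KummerMinimalWitnessInvarianceB) :
    KummerCubeRootCongruenceOfBoundedOfUDC :=
  kummerCubeRootCongruenceOfBoundedOfUDC_of_nearCusp
    (kummerCubeRootModularFormWitnessNearCusp_of_piecesB hINT hDICT hRATB hHOLB hQEXNB hINVB)

end Summit.BirchSwinnertonDyer.Rank1Residual.ManinAdditive.UDCKummerWitnessLine

end
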